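import Summits.Ventures.YMGap.RobustBall.ZdAxisClustering
import Summits.Ventures.YMGap.SlabAreaLaw
import Literature.Probability.LatticeModels.CorrelationDecay
import Literature.MathematicalPhysics.QuantumLattice.LatticeGaugeDLRGibbsProofs
import HarnessLib

/-!
# Robust ball (Y2) — the MASSIVE-STATE reading of the axis-rate clustering: translates of local observables decay at rate
# `−2 log φ` in the `ℓ∞` distance, for EVERY DLR state of `SU(N)` lattice Yang–Mills in the Dobrushin window

HONEST FRAMING: venture file of the cell `pub-ymgap` (QuantumFields programme), track ROBUST-BALL, seat rb-p2 (g10).  Strong-coupling LATTICE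
statement: a floor on the exponential decay rate of truncated correlations of translates (the clause of the tree's `IsMassiveState` /
`HasExponentialDecayRate`, here with an EXPLICIT rate); not a computation of the mass gap; nothing continuum / spectral / Clay.
CONTENT.  From `ZdAxis.ym_abs_cov_le_axis` (axis-separated supports, decay `φ^{2n}`): for bounded measurable local `f, g` with Frobenius-Lipschitz
vectors and every DLR state `μ` inside the window, `x ↦ cov_μ(f, g ∘ τ_x)` has `HasExponentialDecayRate … (−2 log φ)` (`ℓ∞` norm on `ℤ^d`:
the maximising coordinate of `x` is the separating axis; small shifts are absorbed in the constant) — `ym_hasExponentialDecayRate_axis`;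
`SU(2)`, `d = 4`: rate `log 36 ≥ 3.58` at `β_W = 1/16`, `log(49/4) ≥ 2.50` at `β_W = 1/8` and `log(25/9) ≥ 1.02` at `β_W = 1/5` for EVERY DLR state (`su2_hasExponentialDecayRate_*`).
-/

noncomputable section

open MeasureTheory ProbabilityTheory Filter Topology Function Finset
open scoped NNReal
open Literature.Probability.LatticeModels hiding configShift configShift_apply
open Literature.Probability.LatticeModels.DobrushinMetric
open Literature.MathematicalPhysics.QuantumLattice
open Literature.MathematicalPhysics.QuantumFieldTheory hiding ZdEdge
open Literature.MathematicalPhysics.QuantumFieldTheory.Balaban1983to89.StrongCouplingDobrushinWindow (OneLinkKRModulus)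

namespace Summit.Ventures.YMGap.RobustBall.ZdAxis

variable {d N : ℕ}

/-! ### Translates of local observables -/

section Shift

variable {G : Type*} [MeasurableSpace G]

/-- A translated observable depends on the translated links. [folklore] -/
theorem dependsOn_comp_configShift' {α : Type*} {F : LGConfig d G → α} {B : Finset (ZdEdge d)}
    (hF : DependsOn F (↑B : Set (ZdEdge d))) (v : Site d) :
    DependsOn (F ∘ configShift v) (↑(B.image fun e => (e.1 - v, e.2)) : Set (ZdEdge d)) := by
  intro U V hUV
  simp only [Function.comp_apply]
  refine hF fun e he => ?_
  simp only [configShift_apply]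
  exact hUV _ (Finset.mem_coe.2 (Finset.mem_image_of_mem _ he))

/-- The Lipschitz vector of a translated observable is the translated Lipschitz vector. [folklore] -/
theorem isLipBound_comp_configShift {r : G → G → ℝ} {F : LGConfig d G → ℝ} {δ : ZdEdge d → ℝ}
    (hF : IsLipBound r F δ) (v : Site d) : IsLipBound r (F ∘ configShift v) fun e => δ (e.1 + v, e.2) := by
  refine ⟨fun e => hF.nonneg _, fun y σ τ hστ => ?_⟩
  simp only [Function.comp_apply]
  have h := hF.le (y.1 + v, y.2) (configShift v σ) (configShift v τ) (fun z hz => by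
    simp only [configShift_apply]
    refine hστ _ fun h' => hz ?_
    rw [← h']; simp)
  simpa [configShift_apply] using h

/-- Sum of the translated Lipschitz vector over the translated support. [folklore] -/
theorem sum_image_shift_eq (δ : ZdEdge d → ℝ) (B : Finset (ZdEdge d)) (v : Site d) :
    ∑ e ∈ B.image (fun e => (e.1 - v, e.2)), δ (e.1 + v, e.2) = ∑ e ∈ B, δ e := by
  rw [Finset.sum_image (fun e _ e' _ h => by
    have h1 := congrArg Prod.fst h; have h2 := congrArg Prod.snd h
    simp only at h1 h2
    exact Prod.ext (sub_left_injective h1) h2)]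
  refine Finset.sum_congr rfl fun e _ => ?_
  simp

end Shift

/-! ### The decay rate of translates -/

/-- **TRANSLATES OF LOCAL OBSERVABLES DECAY AT RATE `−2 log φ` IN EVERY DLR STATE** (the `IsMassiveState` clause with an explicit rate).
`d ≥ 2`, `N ≥ 1`, 't Hooft `β`, `OneLinkKRModulus N R K` on `R ≥ 2(d−1)|β|`, `κ = K|β|`, `0 < φ < 1` with the parallel / transverse axis
conditions and `6(d−1)κ < 1` (as in `ym_abs_cov_le_axis`).  Then for every DLR state `μ` and all bounded measurable local `f, g` with
Frobenius-Lipschitz vectors: `HasExponentialDecayRate (x ↦ cov_μ(f, g ∘ τ_x)) (−2 log φ)` (`ℓ∞` norm on `ℤ^d`). [folklore] -/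
theorem ym_hasExponentialDecayRate_axis (hd : 2 ≤ d) (hN : 1 ≤ N) {β R K : ℝ} (hK : 0 ≤ K)
    (hR : |β| * (2 * ((d : ℝ) - 1)) ≤ R) (hmod : OneLinkKRModulus N R K) {φ : ℝ} (hφ0 : 0 < φ) (hφ1 : φ < 1)
    (hpar : K * |β| * (2 * ((d - 1 : ℕ) : ℝ) * (φ⁻¹ + 1 + φ)) ≤ 1)
    (hperp : K * |β| * (φ⁻¹ ^ 2 + 2 * φ⁻¹ + 2 * φ + φ ^ 2 + 6 * ((d - 2 : ℕ) : ℝ)) ≤ 1)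
    (hρ : 6 * ((d : ℝ) - 1) * |β| * K < 1)
    {μ : Measure (LGConfig d (Matrix.specialUnitaryGroup (Fin N) ℂ))}
    (hμ : μ ∈ ymGibbsMeasures (d := d) (fundamentalRep (Fin N)) (N * β))
    {f g : LGConfig d (Matrix.specialUnitaryGroup (Fin N) ℂ) → ℝ} (hfm : Measurable f) {Δf : Finset (ZdEdge d)}
    (hfdep : DependsOn f (↑Δf : Set (ZdEdge d))) {Mf : ℝ} (hMf : ∀ σ, |f σ| ≤ Mf) {δf : ZdEdge d → ℝ}
    (hδf : IsLipBound suFrobDist f δf) (hgm : Measurable g) {Δg : Finset (ZdEdge d)}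
    (hgdep : DependsOn g (↑Δg : Set (ZdEdge d))) {Mg : ℝ} (hMg : ∀ σ, |g σ| ≤ Mg) {δg : ZdEdge d → ℝ}
    (hδg : IsLipBound suFrobDist g δg) :
    HasExponentialDecayRate (fun x : Site d => cov[f, g ∘ configShift x; μ]) (-2 * Real.log φ) := by
  classical
  have hμ' : IsGibbsMeasure (ymSpecification (d := d) (fundamentalRep (Fin N)) (N * β)) μ := hμ
  haveI := hμ'.isProbabilityMeasure
  have hlog : Real.log φ < 0 := Real.log_neg hφ0 hφ1
  refine ⟨by linarith, ?_⟩
  -- the doubled axis coordinates and a common width bound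
  set H : Fin d → ZdEdge d → ℤ := fun i z => 2 * z.1 i + (if z.2 = i then 1 else 0) with hH
  set W : ℕ := ∑ e ∈ Δf, ∑ i, (H i e).natAbs + ∑ e ∈ Δg, ∑ i, (H i e).natAbs with hWdef
  have hWf : ∀ i, ∀ e ∈ Δf, |H i e| ≤ W := by
    intro i e he
    have h2 := Finset.single_le_sum (f := fun j => (H j e).natAbs) (fun _ _ => Nat.zero_le _) (Finset.mem_univ i)
    have h1 := Finset.single_le_sum (f := fun e => ∑ j, (H j e).natAbs) (fun _ _ => Nat.zero_le _) he
    have hnat : (H i e).natAbs ≤ W := (h2.trans h1).trans (Nat.le_add_right _ _)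
    rw [← Int.natCast_natAbs]; exact_mod_cast hnat
  have hWg : ∀ i, ∀ e ∈ Δg, |H i e| ≤ W := by
    intro i e he
    have h2 := Finset.single_le_sum (f := fun j => (H j e).natAbs) (fun _ _ => Nat.zero_le _) (Finset.mem_univ i)
    have h1 := Finset.single_le_sum (f := fun e => ∑ j, (H j e).natAbs) (fun _ _ => Nat.zero_le _) he
    have hnat : (H i e).natAbs ≤ W := (h2.trans h1).trans (Nat.le_add_left _ _)
    rw [← Int.natCast_natAbs]; exact_mod_cast hnat
  -- constants
  set S : ℝ := 8 * N * (∑ y ∈ Δg, δg y) * (∑ x ∈ Δf, δf x) with hS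
  have hS0 : 0 ≤ S := by
    have := Finset.sum_nonneg fun y (_ : y ∈ Δg) => hδg.nonneg y
    have := Finset.sum_nonneg fun x (_ : x ∈ Δf) => hδf.nonneg x
    positivity
  obtain ⟨U₀⟩ : Nonempty (LGConfig d (Matrix.specialUnitaryGroup (Fin N) ℂ)) := ⟨fun _ => 1⟩
  have hMf0 : 0 ≤ Mf := (abs_nonneg _).trans (hMf U₀)
  have hMg0 : 0 ≤ Mg := (abs_nonneg _).trans (hMg U₀)
  set T : ℝ := 2 * Mf * (2 * Mg) with hT
  have hT0 : 0 ≤ T := by positivity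
  have hφW : 0 < φ ^ (4 * W) := pow_pos hφ0 _
  refine ⟨(S + T) * (φ ^ (4 * W))⁻¹, fun x => ?_⟩
  -- the translated observable
  set gx : LGConfig d (Matrix.specialUnitaryGroup (Fin N) ℂ) → ℝ := g ∘ configShift x with hgx
  have hgxm : Measurable gx := hgm.comp (configShift x).measurable
  have hgxdep : DependsOn gx (↑(Δg.image fun e => (e.1 - x, e.2)) : Set (ZdEdge d)) := dependsOn_comp_configShift' hgdep x
  have hgxb : ∀ σ, |gx σ| ≤ Mg := fun σ => hMg _
  have hgxL : IsLipBound suFrobDist gx fun e => δg (e.1 + x, e.2) := isLipBound_comp_configShift hδg x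
  have hsumx : ∑ e ∈ Δg.image (fun e => (e.1 - x, e.2)), δg (e.1 + x, e.2) = ∑ e ∈ Δg, δg e := sum_image_shift_eq δg Δg x
  have hHx : ∀ i, ∀ e' ∈ Δg.image (fun e => (e.1 - x, e.2)), ∃ e ∈ Δg, H i e' = H i e - 2 * x i := by
    intro i e' he'
    obtain ⟨e, he, rfl⟩ := Finset.mem_image.1 he'
    exact ⟨e, he, by simp only [hH, Pi.sub_apply]; ring⟩
  -- trivial bound and the target shape
  have htriv : |cov[f, gx; μ]| ≤ T := Slab.abs_cov_le_of_abs_le hMf hgxb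
  have hd1 : 0 < d := by omega
  obtain ⟨i₀, -, hi₀⟩ := Finset.exists_max_image Finset.univ (fun i : Fin d => |x i|) ⟨⟨0, hd1⟩, Finset.mem_univ _⟩
  set t : ℤ := x i₀ with ht
  have hnorm : ‖x‖ ≤ (|t| : ℤ) := by
    have h0 : (0 : ℝ) ≤ ((|t| : ℤ) : ℝ) := by exact_mod_cast abs_nonneg t
    refine (pi_norm_le_iff_of_nonneg h0).2 fun j => ?_
    rw [Int.norm_eq_abs]
    exact_mod_cast hi₀ j (Finset.mem_univ j)
  -- `exp(-m ‖x‖) = φ^{2‖x‖} ≥ φ^{2|t|}`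
  have hexp : φ ^ (2 * t.natAbs) ≤ Real.exp (-(-2 * Real.log φ) * ‖x‖) := by
    rw [show -(-2 * Real.log φ) * ‖x‖ = Real.log φ * (2 * ‖x‖) by ring, ← Real.rpow_def_of_pos hφ0, ← Real.rpow_natCast]
    refine Real.rpow_le_rpow_of_exponent_ge hφ0 hφ1.le ?_
    have : ((|t| : ℤ) : ℝ) = (t.natAbs : ℝ) := by rw [← Int.natCast_natAbs, Int.cast_natCast]
    push_cast; nlinarith [hnorm, this]
  -- it suffices to bound by `(S + T) φ^{-4W} φ^{2|t|}`
  suffices hmain : |cov[f, gx; μ]| ≤ (S + T) * (φ ^ (4 * W))⁻¹ * φ ^ (2 * t.natAbs) by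
    exact hmain.trans (mul_le_mul_of_nonneg_left hexp (by positivity))
  by_cases hsmall : t.natAbs < 2 * W
  · -- small shift: trivial bound, `φ^{2|t|} ≥ φ^{4W}`
    have hpow : φ ^ (4 * W) ≤ φ ^ (2 * t.natAbs) := pow_le_pow_of_le_one hφ0.le hφ1.le (by omega)
    have h1 : 1 ≤ (φ ^ (4 * W))⁻¹ * φ ^ (2 * t.natAbs) := by
      rw [le_inv_mul_iff₀ hφW, mul_one]; exact hpow
    calc |cov[f, gx; μ]| ≤ T := htriv
      _ ≤ (S + T) * ((φ ^ (4 * W))⁻¹ * φ ^ (2 * t.natAbs)) := by nlinarith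
      _ = (S + T) * (φ ^ (4 * W))⁻¹ * φ ^ (2 * t.natAbs) := by ring
  · -- large shift along the axis `i₀`: the axis-rate clustering, in one of the two orientations
    have hbig : 2 * W ≤ t.natAbs := by omega
    -- supports nonempty (else the covariance vanishes)
    by_cases hΔf : Δf = ∅
    · have hfc : f = fun _ => f U₀ := funext fun U => hfdep (by simp [hΔf])
      rw [hfc, covariance_const_left]; simp only [abs_zero]; positivity
    by_cases hΔg : Δg = ∅
    · have hgc : gx = fun _ => g U₀ := funext fun U => by
        simp only [hgx, Function.comp_apply]; exact hgdep (by simp [hΔg])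
      rw [hgc, covariance_const_right]; simp only [abs_zero]; positivity
    obtain ⟨f₀, hf₀⟩ := Finset.nonempty_iff_ne_empty.2 hΔf
    obtain ⟨e₀, he₀⟩ := Finset.nonempty_iff_ne_empty.2 hΔg
    set n : ℕ := t.natAbs - 2 * W with hn
    have hn' : (n : ℤ) = |t| - 2 * W := by rw [hn, Nat.cast_sub hbig, Int.natCast_natAbs]; push_cast; ring
    have hφn : φ ^ (2 * n) = (φ ^ (4 * W))⁻¹ * φ ^ (2 * t.natAbs) := by
      rw [eq_inv_mul_iff_mul_eq₀ hφW.ne', ← pow_add]; congr 1; omega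
    have hWfe : ∀ e ∈ Δf, |H i₀ e - H i₀ f₀| ≤ 2 * W := fun e he => by
      have := hWf i₀ e he; have := hWf i₀ f₀ hf₀
      rw [abs_le] at *; constructor <;> linarith
    have hWge : ∀ e ∈ Δg, |H i₀ e - H i₀ f₀| ≤ 2 * W := fun e he => by
      have := hWg i₀ e he; have := hWf i₀ f₀ hf₀
      rw [abs_le] at *; constructor <;> linarith
    rcases le_or_gt t 0 with ht0 | ht0
    · -- `t ≤ 0`: the translate of `g` lies ABOVE `f` along `i₀`
      have htabs : |t| = -t := abs_of_nonpos ht0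
      have key := ym_abs_cov_le_axis hd hN hK hR hmod hφ0 hφ1.le hpar hperp hρ hμ hfm hfdep hMf hδf hgxm hgxdep hgxb hgxL
        i₀ (H i₀ f₀ - 2 * W - 2 * t) n
        (fun e' he' => by
          obtain ⟨e, he, hHe⟩ := hHx i₀ e' he'
          have h1 := hWge e he
          change H i₀ f₀ - 2 * W - 2 * t ≤ H i₀ e'
          rw [hHe, abs_le] at *; linarith [h1.1])
        (fun e he => by
          have h1 := hWfe e he
          change H i₀ e + 2 * (n : ℤ) ≤ H i₀ f₀ - 2 * W - 2 * t
          rw [hn', htabs]; rw [abs_le] at h1; linarith [h1.2])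
      rw [hsumx, hφn] at key
      calc |cov[f, gx; μ]| ≤ S * ((φ ^ (4 * W))⁻¹ * φ ^ (2 * t.natAbs)) := by rw [hS]; exact key
        _ ≤ (S + T) * ((φ ^ (4 * W))⁻¹ * φ ^ (2 * t.natAbs)) :=
            mul_le_mul_of_nonneg_right (by linarith) (by positivity)
        _ = _ := by ring
    · -- `t > 0`: the translate of `g` lies BELOW `f`; use the symmetry of the covariance
      have htabs : |t| = t := abs_of_pos ht0
      rw [covariance_comm]
      have key := ym_abs_cov_le_axis hd hN hK hR hmod hφ0 hφ1.le hpar hperp hρ hμ hgxm hgxdep hgxb hgxL hfm hfdep hMf hδf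
        i₀ (H i₀ f₀ - 2 * W) n
        (fun e he => by
          have h1 := hWfe e he
          change H i₀ f₀ - 2 * W ≤ H i₀ e
          rw [abs_le] at h1; linarith [h1.1])
        (fun e' he' => by
          obtain ⟨e, he, hHe⟩ := hHx i₀ e' he'
          have h1 := hWge e he
          change H i₀ e' + 2 * (n : ℤ) ≤ H i₀ f₀ - 2 * W
          rw [hHe, hn', htabs]; rw [abs_le] at h1; linarith [h1.2])
      rw [hsumx, hφn] at key
      calc |cov[gx, f; μ]| ≤ 8 * N * (∑ x ∈ Δf, δf x) * (∑ y ∈ Δg, δg y) * ((φ ^ (4 * W))⁻¹ * φ ^ (2 * t.natAbs)) := key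
        _ = S * ((φ ^ (4 * W))⁻¹ * φ ^ (2 * t.natAbs)) := by rw [hS]; ring
        _ ≤ (S + T) * ((φ ^ (4 * W))⁻¹ * φ ^ (2 * t.natAbs)) :=
            mul_le_mul_of_nonneg_right (by linarith) (by positivity)
        _ = _ := by ring

/-- ★ **`SU(2)`, `d = 4`, `β_W = 1/8`: every DLR state is massive with rate `≥ log(49/4) ≥ 2.50` per lattice unit** — translates of any
two bounded measurable local observables with Frobenius-Lipschitz vectors have `HasExponentialDecayRate … (−2 log(2/7))` (the tree's
row-sum rate at this coupling is `log(16/9) ≈ 0.575`). [folklore] -/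
theorem su2_hasExponentialDecayRate_oneEighth {μ : Measure (LGConfig 4 (Matrix.specialUnitaryGroup (Fin 2) ℂ))}
    (hμ : μ ∈ ymGibbsMeasures (d := 4) (fundamentalRep (Fin 2)) (2 * (1 / 32)))
    {f g : LGConfig 4 (Matrix.specialUnitaryGroup (Fin 2) ℂ) → ℝ} (hfm : Measurable f) {Δf : Finset (ZdEdge 4)}
    (hfdep : DependsOn f (↑Δf : Set (ZdEdge 4))) {Mf : ℝ} (hMf : ∀ σ, |f σ| ≤ Mf) {δf : ZdEdge 4 → ℝ}
    (hδf : IsLipBound suFrobDist f δf) (hgm : Measurable g) {Δg : Finset (ZdEdge 4)}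
    (hgdep : DependsOn g (↑Δg : Set (ZdEdge 4))) {Mg : ℝ} (hMg : ∀ σ, |g σ| ≤ Mg) {δg : ZdEdge 4 → ℝ}
    (hδg : IsLipBound suFrobDist g δg) :
    HasExponentialDecayRate (fun x : Site 4 => cov[f, g ∘ configShift x; μ]) (-2 * Real.log (2 / 7)) := by
  have hmod := SlabAreaLawDimensions.su2_oneLinkKRModulus_of_le_one (R := 3 / 16) (by norm_num)
  have habs : |(1 / 32 : ℝ)| = 1 / 32 := abs_of_pos (by norm_num)
  exact ym_hasExponentialDecayRate_axis (d := 4) (N := 2) (by norm_num) (by norm_num) (β := 1 / 32) zero_le_one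
    (by rw [habs]; norm_num) hmod (φ := 2 / 7) (by norm_num) (by norm_num)
    (by rw [habs]; norm_num) (by rw [habs]; norm_num) (by rw [habs]; norm_num)
    hμ hfm hfdep hMf hδf hgm hgdep hMg hδg

/-- ★ **`SU(2)`, `d = 4`, `β_W = 1/5`: every DLR state is massive with rate `≥ log(25/9) ≥ 1.02` per lattice unit** (row-sum rate
`log(10/9) ≈ 0.105`). [folklore] -/
theorem su2_hasExponentialDecayRate_oneFifth {μ : Measure (LGConfig 4 (Matrix.specialUnitaryGroup (Fin 2) ℂ))}
    (hμ : μ ∈ ymGibbsMeasures (d := 4) (fundamentalRep (Fin 2)) (2 * (1 / 20)))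
    {f g : LGConfig 4 (Matrix.specialUnitaryGroup (Fin 2) ℂ) → ℝ} (hfm : Measurable f) {Δf : Finset (ZdEdge 4)}
    (hfdep : DependsOn f (↑Δf : Set (ZdEdge 4))) {Mf : ℝ} (hMf : ∀ σ, |f σ| ≤ Mf) {δf : ZdEdge 4 → ℝ}
    (hδf : IsLipBound suFrobDist f δf) (hgm : Measurable g) {Δg : Finset (ZdEdge 4)}
    (hgdep : DependsOn g (↑Δg : Set (ZdEdge 4))) {Mg : ℝ} (hMg : ∀ σ, |g σ| ≤ Mg) {δg : ZdEdge 4 → ℝ}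
    (hδg : IsLipBound suFrobDist g δg) :
    HasExponentialDecayRate (fun x : Site 4 => cov[f, g ∘ configShift x; μ]) (-2 * Real.log (3 / 5)) := by
  have hmod := SlabAreaLawDimensions.su2_oneLinkKRModulus_of_le_one (R := 3 / 10) (by norm_num)
  have habs : |(1 / 20 : ℝ)| = 1 / 20 := abs_of_pos (by norm_num)
  exact ym_hasExponentialDecayRate_axis (d := 4) (N := 2) (by norm_num) (by norm_num) (β := 1 / 20) zero_le_one
    (by rw [habs]; norm_num) hmod (φ := 3 / 5) (by norm_num) (by norm_num)
    (by rw [habs]; norm_num) (by rw [habs]; norm_num) (by rw [habs]; norm_num)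
    hμ hfm hfdep hMf hδf hgm hgdep hMg hδg


/-- ★ **`SU(2)`, `d = 4`, `β_W = 1/16`: every DLR state is massive with rate `≥ log 36 ≥ 3.58` per lattice unit** (row-sum rate `log(32/9) ≈ 1.27`).
[folklore] -/
theorem su2_hasExponentialDecayRate_oneSixteenth {μ : Measure (LGConfig 4 (Matrix.specialUnitaryGroup (Fin 2) ℂ))}
    (hμ : μ ∈ ymGibbsMeasures (d := 4) (fundamentalRep (Fin 2)) (2 * (1 / 64)))
    {f g : LGConfig 4 (Matrix.specialUnitaryGroup (Fin 2) ℂ) → ℝ} (hfm : Measurable f) {Δf : Finset (ZdEdge 4)}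
    (hfdep : DependsOn f (↑Δf : Set (ZdEdge 4))) {Mf : ℝ} (hMf : ∀ σ, |f σ| ≤ Mf) {δf : ZdEdge 4 → ℝ}
    (hδf : IsLipBound suFrobDist f δf) (hgm : Measurable g) {Δg : Finset (ZdEdge 4)}
    (hgdep : DependsOn g (↑Δg : Set (ZdEdge 4))) {Mg : ℝ} (hMg : ∀ σ, |g σ| ≤ Mg) {δg : ZdEdge 4 → ℝ}
    (hδg : IsLipBound suFrobDist g δg) :
    HasExponentialDecayRate (fun x : Site 4 => cov[f, g ∘ configShift x; μ]) (-2 * Real.log (1 / 6)) := by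
  have hmod := SlabAreaLawDimensions.su2_oneLinkKRModulus_of_le_one (R := 3 / 32) (by norm_num)
  have habs : |(1 / 64 : ℝ)| = 1 / 64 := abs_of_pos (by norm_num)
  exact ym_hasExponentialDecayRate_axis (d := 4) (N := 2) (by norm_num) (by norm_num) (β := 1 / 64) zero_le_one
    (by rw [habs]; norm_num) hmod (φ := 1 / 6) (by norm_num) (by norm_num)
    (by rw [habs]; norm_num) (by rw [habs]; norm_num) (by rw [habs]; norm_num)
    hμ hfm hfdep hMf hδf hgm hgdep hMg hδg


/-- ★★ **`SU(2)`, `d = 4`, `β_W = 1/8`: every INFINITE-VOLUME LIMIT STATE of the torus Wilson states is massive with rate `≥ log(49/4)`** —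
the same states for which `StringTensionAxisFloor.su2_stringTension_ge_sharp_dim4` gives `σ ≥ log 26` (tight limits are DLR states,
`mem_ymGibbsMeasures_of_mem_infiniteVolumeLimitPoints_holds`). [folklore] -/
theorem su2_limitState_hasExponentialDecayRate_oneEighth {μ : Measure (LGConfig 4 (Matrix.specialUnitaryGroup (Fin 2) ℂ))}
    (hμ : μ ∈ infiniteVolumeLimitPoints (d := 4) (fundamentalRep (Fin 2)) ((1 / 8 : ℝ) / 2))
    {f g : LGConfig 4 (Matrix.specialUnitaryGroup (Fin 2) ℂ) → ℝ} (hfm : Measurable f) {Δf : Finset (ZdEdge 4)}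
    (hfdep : DependsOn f (↑Δf : Set (ZdEdge 4))) {Mf : ℝ} (hMf : ∀ σ, |f σ| ≤ Mf) {δf : ZdEdge 4 → ℝ}
    (hδf : IsLipBound suFrobDist f δf) (hgm : Measurable g) {Δg : Finset (ZdEdge 4)}
    (hgdep : DependsOn g (↑Δg : Set (ZdEdge 4))) {Mg : ℝ} (hMg : ∀ σ, |g σ| ≤ Mg) {δg : ZdEdge 4 → ℝ}
    (hδg : IsLipBound suFrobDist g δg) :
    HasExponentialDecayRate (fun x : Site 4 => cov[f, g ∘ configShift x; μ]) (-2 * Real.log (2 / 7)) := by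
  haveI : SecondCountableTopology (Matrix (Fin 2) (Fin 2) ℂ) :=
    inferInstanceAs (SecondCountableTopology (Fin 2 → Fin 2 → ℂ))
  haveI : SecondCountableTopology (Matrix.specialUnitaryGroup (Fin 2) ℂ) :=
    Topology.IsEmbedding.subtypeVal.secondCountableTopology
  have hDLR := mem_ymGibbsMeasures_of_mem_infiniteVolumeLimitPoints_holds (d := 4) (fundamentalRep (Fin 2))
    (continuous_fundamentalRep (Fin 2)) hμ
  have e : ((1 / 8 : ℝ) / 2) = 2 * (1 / 32) := by norm_num
  rw [e] at hDLR
  exact su2_hasExponentialDecayRate_oneEighth hDLR hfm hfdep hMf hδf hgm hgdep hMg hδg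


/-- ★★ **`SU(2)`, `d = 4`, CLOSED FORM ON THE WHOLE INTERVAL `0 < β_W ≤ 1/8`: every DLR state of the Wilson specification at tree coupling `β_W/2`
is massive with rate `≥ log(1/β_W)`** (admissible `φ = √β_W`: `(β_W/4)·6(φ⁻¹+1+φ) = (3/2)(φ+φ²+φ³) ≤ 0.86` and
`(β_W/4)(φ⁻²+2φ⁻¹+2φ+φ²+12) = 1/4 + φ/2 + 3φ² + φ³/2 + φ⁴/4 ≤ 0.9` for `φ ≤ 3/8`).  The cells `φ = 1/6, 2/7` at `β_W = 1/16, 1/8` are sharper;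
the tree's row-sum rate is `−log(9β_W/2)`. [folklore] -/
theorem su2_hasExponentialDecayRate_dim4 {βW : ℝ} (hβ : 0 < βW) (hβ1 : βW ≤ 1 / 8)
    {μ : Measure (LGConfig 4 (Matrix.specialUnitaryGroup (Fin 2) ℂ))}
    (hμ : μ ∈ ymGibbsMeasures (d := 4) (fundamentalRep (Fin 2)) (2 * (βW / 4)))
    {f g : LGConfig 4 (Matrix.specialUnitaryGroup (Fin 2) ℂ) → ℝ} (hfm : Measurable f) {Δf : Finset (ZdEdge 4)}
    (hfdep : DependsOn f (↑Δf : Set (ZdEdge 4))) {Mf : ℝ} (hMf : ∀ σ, |f σ| ≤ Mf) {δf : ZdEdge 4 → ℝ}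
    (hδf : IsLipBound suFrobDist f δf) (hgm : Measurable g) {Δg : Finset (ZdEdge 4)}
    (hgdep : DependsOn g (↑Δg : Set (ZdEdge 4))) {Mg : ℝ} (hMg : ∀ σ, |g σ| ≤ Mg) {δg : ZdEdge 4 → ℝ}
    (hδg : IsLipBound suFrobDist g δg) :
    HasExponentialDecayRate (fun x : Site 4 => cov[f, g ∘ configShift x; μ]) (Real.log (1 / βW)) := by
  set t : ℝ := Real.sqrt βW with ht
  have ht0 : 0 < t := Real.sqrt_pos.2 hβ
  have ht2 : t ^ 2 = βW := Real.sq_sqrt hβ.le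
  have ht38 : t ≤ 3 / 8 := by nlinarith [ht2, ht0]
  have ht1 : t < 1 := by linarith
  have htne : t ≠ 0 := ht0.ne'
  have hmod := SlabAreaLawDimensions.su2_oneLinkKRModulus_of_le_one (R := 3 / 8) (by norm_num)
  have habs : |βW / 4| = t ^ 2 / 4 := by rw [abs_of_pos (by positivity), ht2]
  have hpar : 1 * |βW / 4| * (2 * ((4 - 1 : ℕ) : ℝ) * (t⁻¹ + 1 + t)) ≤ 1 := by
    rw [habs]
    have e : 1 * (t ^ 2 / 4) * (2 * ((4 - 1 : ℕ) : ℝ) * (t⁻¹ + 1 + t)) = 3 / 2 * (t + t ^ 2 + t ^ 3) := by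
      push_cast; field_simp; ring
    rw [e]; nlinarith [pow_pos ht0 3, pow_le_pow_left₀ ht0.le ht38 2, pow_le_pow_left₀ ht0.le ht38 3]
  have hperp : 1 * |βW / 4| * (t⁻¹ ^ 2 + 2 * t⁻¹ + 2 * t + t ^ 2 + 6 * ((4 - 2 : ℕ) : ℝ)) ≤ 1 := by
    rw [habs]
    have e : 1 * (t ^ 2 / 4) * (t⁻¹ ^ 2 + 2 * t⁻¹ + 2 * t + t ^ 2 + 6 * ((4 - 2 : ℕ) : ℝ)) =
        1 / 4 + t / 2 + 3 * t ^ 2 + t ^ 3 / 2 + t ^ 4 / 4 := by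
      push_cast; field_simp; ring
    rw [e]
    nlinarith [pow_pos ht0 3, pow_pos ht0 4, pow_le_pow_left₀ ht0.le ht38 2, pow_le_pow_left₀ ht0.le ht38 3,
      pow_le_pow_left₀ ht0.le ht38 4]
  have hρ : 6 * (((4 : ℕ) : ℝ) - 1) * |βW / 4| * 1 < 1 := by rw [habs]; push_cast; nlinarith
  have hR : |βW / 4| * (2 * (((4 : ℕ) : ℝ) - 1)) ≤ 3 / 8 := by rw [habs]; push_cast; nlinarith
  have h := ym_hasExponentialDecayRate_axis (d := 4) (N := 2) (by norm_num) (by norm_num) (β := βW / 4) zero_le_one hR hmod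
    (φ := t) ht0 ht1 hpar hperp hρ hμ hfm hfdep hMf hδf hgm hgdep hMg hδg
  have hlog : -2 * Real.log t = Real.log (1 / βW) := by
    rw [ht, Real.log_sqrt hβ.le, one_div, Real.log_inv]; ring
  rw [hlog] at h
  exact h


/-- ★★ **`SU(2)`, `d = 3`, CLOSED FORM ON `0 < β_W ≤ 1/4`: every DLR state of the Wilson specification at tree coupling `β_W/2` is massive with
rate `≥ log(1/β_W)`** (admissible `φ = √β_W`: `(β_W/4)·4(φ⁻¹+1+φ) = φ+φ²+φ³ ≤ 7/8`, `(β_W/4)(φ⁻²+2φ⁻¹+2φ+φ²+6) = 1/4 + φ/2 + 3φ²/2 + φ³/2 + φ⁴/4 ≤ 0.96`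
at `φ ≤ 1/2`; row-sum rate `−log 3β_W`). [folklore] -/
theorem su2_hasExponentialDecayRate_dim3 {βW : ℝ} (hβ : 0 < βW) (hβ1 : βW ≤ 1 / 4)
    {μ : Measure (LGConfig 3 (Matrix.specialUnitaryGroup (Fin 2) ℂ))}
    (hμ : μ ∈ ymGibbsMeasures (d := 3) (fundamentalRep (Fin 2)) (2 * (βW / 4)))
    {f g : LGConfig 3 (Matrix.specialUnitaryGroup (Fin 2) ℂ) → ℝ} (hfm : Measurable f) {Δf : Finset (ZdEdge 3)}
    (hfdep : DependsOn f (↑Δf : Set (ZdEdge 3))) {Mf : ℝ} (hMf : ∀ σ, |f σ| ≤ Mf) {δf : ZdEdge 3 → ℝ}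
    (hδf : IsLipBound suFrobDist f δf) (hgm : Measurable g) {Δg : Finset (ZdEdge 3)}
    (hgdep : DependsOn g (↑Δg : Set (ZdEdge 3))) {Mg : ℝ} (hMg : ∀ σ, |g σ| ≤ Mg) {δg : ZdEdge 3 → ℝ}
    (hδg : IsLipBound suFrobDist g δg) :
    HasExponentialDecayRate (fun x : Site 3 => cov[f, g ∘ configShift x; μ]) (Real.log (1 / βW)) := by
  set t : ℝ := Real.sqrt βW with ht
  have ht0 : 0 < t := Real.sqrt_pos.2 hβ
  have ht2 : t ^ 2 = βW := Real.sq_sqrt hβ.le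
  have ht12 : t ≤ 1 / 2 := by nlinarith [ht2, ht0]
  have ht1 : t < 1 := by linarith
  have hmod := SlabAreaLawDimensions.su2_oneLinkKRModulus_of_le_one (R := 1 / 4) (by norm_num)
  have habs : |βW / 4| = t ^ 2 / 4 := by rw [abs_of_pos (by positivity), ht2]
  have hpar : 1 * |βW / 4| * (2 * ((3 - 1 : ℕ) : ℝ) * (t⁻¹ + 1 + t)) ≤ 1 := by
    rw [habs]
    have e : 1 * (t ^ 2 / 4) * (2 * ((3 - 1 : ℕ) : ℝ) * (t⁻¹ + 1 + t)) = t + t ^ 2 + t ^ 3 := by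
      push_cast; field_simp; ring
    rw [e]; nlinarith [pow_pos ht0 3, pow_le_pow_left₀ ht0.le ht12 2, pow_le_pow_left₀ ht0.le ht12 3]
  have hperp : 1 * |βW / 4| * (t⁻¹ ^ 2 + 2 * t⁻¹ + 2 * t + t ^ 2 + 6 * ((3 - 2 : ℕ) : ℝ)) ≤ 1 := by
    rw [habs]
    have e : 1 * (t ^ 2 / 4) * (t⁻¹ ^ 2 + 2 * t⁻¹ + 2 * t + t ^ 2 + 6 * ((3 - 2 : ℕ) : ℝ)) =
        1 / 4 + t / 2 + 3 / 2 * t ^ 2 + t ^ 3 / 2 + t ^ 4 / 4 := by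
      push_cast; field_simp; ring
    rw [e]
    nlinarith [pow_pos ht0 3, pow_pos ht0 4, pow_le_pow_left₀ ht0.le ht12 2, pow_le_pow_left₀ ht0.le ht12 3,
      pow_le_pow_left₀ ht0.le ht12 4]
  have hρ : 6 * (((3 : ℕ) : ℝ) - 1) * |βW / 4| * 1 < 1 := by rw [habs]; push_cast; nlinarith
  have hR : |βW / 4| * (2 * (((3 : ℕ) : ℝ) - 1)) ≤ 1 / 4 := by rw [habs]; push_cast; nlinarith
  have h := ym_hasExponentialDecayRate_axis (d := 3) (N := 2) (by norm_num) (by norm_num) (β := βW / 4) zero_le_one hR hmod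
    (φ := t) ht0 ht1 hpar hperp hρ hμ hfm hfdep hMf hδf hgm hgdep hMg hδg
  have hlog : -2 * Real.log t = Real.log (1 / βW) := by
    rw [ht, Real.log_sqrt hβ.le, one_div, Real.log_inv]; ring
  rw [hlog] at h
  exact h

end Summit.Ventures.YMGap.RobustBall.ZdAxis

end
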